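import Summits.AtomisticToContinuum.BoseEinsteinCondensation.Theorems.BECCutLineWeakDisorderWitnessTransferVanishStrongRepulsion
import Literature.MathematicalPhysics.QuantumManyBody.BoseGasHardSet
import HarnessLib

/-!
# Route BECCutLineWeakDisorder — crux `WitnessTransfer`, line `Sketch`, stub (S6): window mass and transverse tail

Two inputs of (S6): (1) the truncated window masses `∫_W min(v, n) ↑ ∫_W v` (finite, eventually
nonzero when `∫_W v = ∞` — at a hard point this is `BoseGas.lintegral_Ioo_eq_top_of_mem_hardRad`);
(2) the **transverse tail**: outside an event of probability `≤ 6 · 2t²/((a/2)² − t)²` all six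
coordinates `b(ω m l)`, `m ∈ {i, j}`, stay below `a` in absolute value up to time `t`
(running-maximum tail), and then the transverse square of the pair difference is `< 12a²`.
-/

noncomputable section

open MeasureTheory Filter Set Metric
open scoped ENNReal NNReal Topology

namespace Summit.AtomisticToContinuum.BoseEinsteinCondensation.Theorems.CutLineWitness

open Literature.MathematicalPhysics.QuantumManyBody.BoseGas
open Literature.Probability.Process

/-! ### Truncated window masses -/

/-- `∫_W min(v, n) ↑ ∫_W v` as `n → ∞`. [folklore] -/
theorem iSup_lintegral_min_natCast {v : ℝ → ℝ≥0∞} (hv : Measurable v) (W : Set ℝ) :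
    ⨆ n : ℕ, ∫⁻ r in W, min (v r) (n : ℝ≥0∞) = ∫⁻ r in W, v r := by
  rw [← lintegral_iSup (fun n => hv.min measurable_const)
    (fun m n hmn r => min_le_min_left _ (by exact_mod_cast hmn))]
  refine lintegral_congr fun r => le_antisymm (iSup_le fun n => min_le_left _ _) ?_
  by_cases hr : v r = ⊤
  · rw [hr]
    simp only [top_le_iff, min_eq_right le_top]
    exact ENNReal.iSup_natCast
  · obtain ⟨n, hn⟩ := ENNReal.exists_nat_gt hr
    exact le_iSup_of_le n (by rw [min_eq_left hn.le])

/-- The truncated window masses are finite. [folklore] -/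
theorem lintegral_min_natCast_Ioo_lt_top (v : ℝ → ℝ≥0∞) (n : ℕ) (a b : ℝ) :
    ∫⁻ r in Ioo a b, min (v r) (n : ℝ≥0∞) < ⊤ := by
  refine (setLIntegral_mono' measurableSet_Ioo (fun r _ => min_le_right (v r) (n : ℝ≥0∞))).trans_lt ?_
  rw [setLIntegral_const]
  exact ENNReal.mul_lt_top (ENNReal.natCast_lt_top _) measure_Ioo_lt_top

/-- Eventually the truncated window masses are nonzero when the full mass is infinite. [folklore] -/
theorem lintegral_min_natCast_ne_zero {v : ℝ → ℝ≥0∞} (hv : Measurable v) {W : Set ℝ}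
    (hW : ∫⁻ r in W, v r = ⊤) {n : ℕ} (hn : 1 ≤ n) : ∫⁻ r in W, min (v r) (n : ℝ≥0∞) ≠ 0 := by
  intro h0
  have hae : ∀ᵐ r ∂(volume.restrict W), min (v r) (n : ℝ≥0∞) = 0 :=
    (lintegral_eq_zero_iff (hv.min measurable_const)).1 h0
  have hae' : ∀ᵐ r ∂(volume.restrict W), v r = 0 := by
    filter_upwards [hae] with r hr
    rcases min_eq_iff.1 hr with h | h
    · exact h.1
    · exact absurd h.1 (by exact_mod_cast (show (n : ℕ) ≠ 0 by omega))
  have : ∫⁻ r in W, v r = 0 := (lintegral_eq_zero_iff hv).2 hae'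
  exact absurd (this ▸ hW) ENNReal.zero_ne_top

/-! ### The transverse tail -/

/-- **Six-coordinate running-maximum tail.** For `0 ≤ a` and `t < (a/2)²`, the event that some
coordinate `b(ω m l)`, `m ∈ {i, j}`, reaches `a` in absolute value before time `t` has
probability `≤ 6 · 2t²/((a/2)² − t)²`. [folklore] -/
theorem measure_exists_runSup_ge_le {N : ℕ} (i j : Fin N) (t : ℝ≥0) {a : ℝ} (ha0 : 0 ≤ a)
    (ha : (t : ℝ) < (a / 2) ^ 2) :
    wienerPaths N {ω | ∃ m ∈ ({i, j} : Finset (Fin N)), ∃ l : Fin 3, a ≤ runSup t (ω m l)} ≤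
      6 * ENNReal.ofReal (2 * (t : ℝ) ^ 2 / ((a / 2) ^ 2 - t) ^ 2) := by
  classical
  have hset : {ω : PathSpace N | ∃ m ∈ ({i, j} : Finset (Fin N)), ∃ l : Fin 3, a ≤ runSup t (ω m l)} =
      ⋃ m ∈ ({i, j} : Finset (Fin N)), ⋃ l ∈ (Finset.univ : Finset (Fin 3)),
        {ω : PathSpace N | a ≤ runSup t (ω m l)} := by
    ext ω; simp
  rw [hset]
  refine (measure_biUnion_finset_le _ _).trans ?_
  calc ∑ m ∈ ({i, j} : Finset (Fin N)), wienerPaths N (⋃ l ∈ (Finset.univ : Finset (Fin 3)),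
          {ω : PathSpace N | a ≤ runSup t (ω m l)})
      ≤ ∑ m ∈ ({i, j} : Finset (Fin N)), ∑ l ∈ (Finset.univ : Finset (Fin 3)),
          ENNReal.ofReal (2 * (t : ℝ) ^ 2 / ((a / 2) ^ 2 - t) ^ 2) := by
        refine Finset.sum_le_sum fun m _ => (measure_biUnion_finset_le _ _).trans ?_
        exact Finset.sum_le_sum fun l _ => measure_runSup_coord_ge_le m l t ha0 ha
    _ ≤ 6 * ENNReal.ofReal (2 * (t : ℝ) ^ 2 / ((a / 2) ^ 2 - t) ^ 2) := by
        rw [Finset.sum_const, Finset.sum_const, Finset.card_univ, Fintype.card_fin, nsmul_eq_mul,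
          nsmul_eq_mul, ← mul_assoc]
        gcongr
        have hc : (({i, j} : Finset (Fin N)).card : ℝ≥0∞) ≤ 2 := by
          exact_mod_cast Finset.card_le_two
        calc (({i, j} : Finset (Fin N)).card : ℝ≥0∞) * (3 : ℕ) ≤ 2 * 3 := by
              push_cast; gcongr
          _ = 6 := by norm_num

/-- **Transverse control from coordinate control.** If all six coordinates stay below `a` in
absolute value up to time `t`, then for `s ≤ t` the pair difference `d_s` has `∑ d_l² < 12a²`,
hence (unit `e`) its transverse square `∑ (d_l − (∑ e_l d_l) e_l)² < 12 a²`. [folklore] -/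
theorem transverse_sq_lt_of_runSup_lt {N : ℕ} {i j : Fin N} {t : ℝ≥0} {a : ℝ} {ω : PathSpace N}
    (h : ∀ m ∈ ({i, j} : Finset (Fin N)), ∀ l : Fin 3, runSup t (ω m l) < a) (e : Space)
    (he : ‖e‖ = 1) {s : ℝ≥0} (hs : s ≤ t) :
    ∑ l, ((brownian s (ω i l) - brownian s (ω j l)) -
      (∑ l', e l' * (brownian s (ω i l') - brownian s (ω j l'))) * e l) ^ 2 < 12 * a ^ 2 := by
  set d : Fin 3 → ℝ := fun l => brownian s (ω i l) - brownian s (ω j l) with hd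
  set U : ℝ := ∑ l', e l' * d l' with hU
  have he2 : ∑ l, e l ^ 2 = 1 := by
    have := EuclideanSpace.real_norm_sq_eq e
    rw [he, one_pow] at this
    exact this.symm
  have hid : ∑ l, (d l - U * e l) ^ 2 = ∑ l, d l ^ 2 - U ^ 2 := by
    have : ∀ l, (d l - U * e l) ^ 2 = d l ^ 2 - 2 * U * (e l * d l) + U ^ 2 * e l ^ 2 := by
      intro l; ring
    simp only [this, Finset.sum_add_distrib, Finset.sum_sub_distrib, ← Finset.mul_sum, ← hU, he2]
    ring
  have hdl : ∀ l, |d l| < 2 * a := by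
    intro l
    have hi := h i (by simp) l
    have hj := h j (by simp) l
    have h1 := abs_brownian_le_runSup hs (ω i l)
    have h2 := abs_brownian_le_runSup hs (ω j l)
    calc |d l| ≤ |brownian s (ω i l)| + |brownian s (ω j l)| := abs_sub _ _
      _ < a + a := add_lt_add (h1.trans_lt hi) (h2.trans_lt hj)
      _ = 2 * a := by ring
  have hd2 : ∀ l, d l ^ 2 < 4 * a ^ 2 := fun l => by
    have := hdl l
    have h0 : 0 ≤ |d l| := abs_nonneg _
    nlinarith [sq_abs (d l), abs_nonneg (d l)]
  change ∑ l, (d l - U * e l) ^ 2 < 12 * a ^ 2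
  rw [hid]
  have hsum : ∑ l, d l ^ 2 < 12 * a ^ 2 := by
    simp only [Fin.sum_univ_three]; linarith [hd2 0, hd2 1, hd2 2]
  nlinarith [sq_nonneg U]

end Summit.AtomisticToContinuum.BoseEinsteinCondensation.Theorems.CutLineWitness

end
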